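import Mathlib
import Summits.PneNP.PneNP.Theorems.PstarProductRank

/-!
# Biases of quadratic functions over `𝔽₂`: `ε² ≤ |D| · |rad D|` (ROUND-24, T24.11c infrastructure)

FRONTIER range-avoidance ladder, rung F-N3, ROUND 24 (cell `pnp-ideate`; elementary character sums for the bias identity of the
graph-quadratic gap targets `PstarGraphQuadGap.GraphQuadGapTwo` / bounded-`s` — nothing here bears on `P` versus `NP`).

Everything is over the two-element field with the sign character `chi t = (−1)^t ∈ ℤ` and finite sums; no Fourier library is used.

* `sum_chi_eq_zero_of_shift` (pairing): if a finite set `S` is stable under `x ↦ x + u₁` and `g (x + u₁) = g x + 1` on `S`, then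
  `Σ_{x∈S} chi (g x) = 0`.
* `bias_sq_le` (**the bias bound**): let `f : V → 𝔽₂` be QUADRATIC with polar form `B`, i.e. `f (x + w) = f x + f w − f 0 + B x w`
  (`quadratic_of_qform`: every `qform + linear + constant` is), `D ≤ V` a subspace with element set `𝒟`, `ℛ` the element set of the
  radical `D ⊓ B.orthogonal D`, and `b₀` a base point.  Then the bias `ε = Σ_{u ∈ 𝒟} chi (f (b₀ + u))` satisfies `ε² ≤ |𝒟| · |ℛ|`.
  Proof: `ε² = Σ_{u,w ∈ D} chi (f(b₀+u) + f(b₀+u+w)) = Σ_w chi (g w) · Σ_u chi (B u w)` with `g w = f w − f 0 + B b₀ w`; the inner sum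
  is `|𝒟|` if `w` is in the radical and `0` otherwise (pairing), so `ε² = |𝒟| · Σ_{w ∈ ℛ} chi (g w) ≤ |𝒟| · |ℛ|`.
* `card_le_abs_add` (**unsat identity for two constraints**): if no `u ∈ S` has `F₁ u = F₂ u = 0` then
  `|S| + Σ chi F₁ + Σ chi F₂ + Σ chi (F₁ + F₂) = 0`, hence `|S| ≤ |Σ chi F₁| + |Σ chi F₂| + |Σ chi (F₁+F₂)|`.
* `card_eq_two_pow_finrank`: the element set of a subspace `P` has `2 ^ finrank P` elements.
-/

set_option linter.dupNamespace false -- `Summit.PneNP.PneNP.…`: summit = sub-problem name (D-0017 single-conjunct layout)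

open Finset Module
open Summit.PneNP.PneNP.Theorems.PstarProductRank (qform polar qform_add)

namespace Summit.PneNP.PneNP.Theorems.PstarQuadBias

/-! ## The sign character of `𝔽₂` -/

/-- The sign character `χ(t) = (−1)^t` of `𝔽₂`, valued in `ℤ`. -/
def chi (t : ZMod 2) : ℤ := if t = 0 then 1 else -1

/-- `χ(0) = 1`. -/
@[simp] theorem chi_zero : chi 0 = 1 := rfl

/-- `χ` is multiplicative: `χ(s + t) = χ(s) χ(t)`. -/
theorem chi_add (s t : ZMod 2) : chi (s + t) = chi s * chi t := by
  unfold chi; revert s t; decide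

/-- `χ(t + 1) = −χ(t)`. -/
theorem chi_add_one (t : ZMod 2) : chi (t + 1) = -chi t := by
  unfold chi; revert t; decide

/-- `χ ≤ 1`. -/
theorem chi_le_one (t : ZMod 2) : chi t ≤ 1 := by
  unfold chi; split_ifs <;> norm_num

/-- `χ(t) = −1` off zero. -/
theorem chi_of_ne_zero {t : ZMod 2} (h : t ≠ 0) : chi t = -1 := if_neg h

/-- In `𝔽₂`, `x + x = 0`. -/
private theorem zmod2_add_self (x : ZMod 2) : x + x = 0 := by
  revert x; decide

/-- A non-zero element of `𝔽₂` is `1`. -/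
private theorem zmod2_eq_one_of_ne_zero {x : ZMod 2} (h : x ≠ 0) : x = 1 := by
  revert x h; decide

section Module

variable {V : Type*} [AddCommGroup V] [Module (ZMod 2) V]

/-- In an `𝔽₂`-space, `u + u = 0`. -/
private theorem add_self_eq_zero (u : V) : u + u = 0 := by
  rw [← two_smul (ZMod 2) u, show (2 : ZMod 2) = 0 from rfl, zero_smul]

/-! ## Pairing: character sums of a flipped function vanish -/

/-- **Pairing lemma.**  If `S` is stable under the translation `x ↦ x + u₁` and `g (x + u₁) = g x + 1` on `S`, then
`Σ_{x ∈ S} χ(g x) = 0`. -/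
theorem sum_chi_eq_zero_of_shift [DecidableEq V] (S : Finset V) (u₁ : V) (hS : ∀ x ∈ S, x + u₁ ∈ S) (g : V → ZMod 2)
    (hg : ∀ x ∈ S, g (x + u₁) = g x + 1) : ∑ x ∈ S, chi (g x) = 0 := by
  have hinv : ∀ x ∈ S, x + u₁ + u₁ = x := fun x _ => by rw [add_assoc, add_self_eq_zero, add_zero]
  have h1 : ∑ x ∈ S, chi (g (x + u₁)) = ∑ x ∈ S, chi (g x) :=
    sum_nbij' (· + u₁) (· + u₁) hS hS hinv hinv fun _ _ => rfl
  have h2 : ∑ x ∈ S, chi (g (x + u₁)) = -∑ x ∈ S, chi (g x) := by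
    rw [← sum_neg_distrib]
    exact sum_congr rfl fun x hx => by rw [hg x hx, chi_add_one]
  linarith

/-- Character sum of the functional `u ↦ B u w` over (the element set of) a subspace on which it vanishes: `|𝒟|`. -/
theorem sum_chi_bilin_of_forall (B : LinearMap.BilinForm (ZMod 2) V) (D : Submodule (ZMod 2) V) (𝒟 : Finset V)
    (h𝒟 : ∀ x, x ∈ 𝒟 ↔ x ∈ D) {w : V} (h : ∀ n ∈ D, B n w = 0) :
    ∑ u ∈ 𝒟, chi (B u w) = (𝒟.card : ℤ) := by
  rw [show (𝒟.card : ℤ) = ∑ u ∈ 𝒟, (1 : ℤ) by simp]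
  exact sum_congr rfl fun u hu => by rw [h u ((h𝒟 u).1 hu), chi_zero]

/-- Character sum of the functional `u ↦ B u w` over (the element set of) a subspace on which it does not vanish: `0`. -/
theorem sum_chi_bilin_of_exists [DecidableEq V] (B : LinearMap.BilinForm (ZMod 2) V) (D : Submodule (ZMod 2) V)
    (𝒟 : Finset V) (h𝒟 : ∀ x, x ∈ 𝒟 ↔ x ∈ D) {w : V} (h : ∃ n ∈ D, B n w ≠ 0) :
    ∑ u ∈ 𝒟, chi (B u w) = 0 := by
  obtain ⟨u₁, hu₁, hne⟩ := h
  refine sum_chi_eq_zero_of_shift 𝒟 u₁ (fun x hx => (h𝒟 _).2 (D.add_mem ((h𝒟 x).1 hx) hu₁)) (fun u => B u w)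
    fun x _ => ?_
  rw [map_add, LinearMap.add_apply, zmod2_eq_one_of_ne_zero hne]

/-! ## The bias bound -/

/-- A product sum plus a linear part plus a constant is quadratic with polar form `polar`:
`f (x + w) = f x + f w − f 0 + B x w`. -/
theorem quadratic_of_qform {K : Type*} [Field K] {ι κ : Type*} (J : Finset κ) (p q : κ → ι) (L : (ι → K) →ₗ[K] K) (c : K)
    (x w : ι → K) :
    (qform J p q (x + w) + L (x + w) + c) =
      (qform J p q x + L x + c) + (qform J p q w + L w + c) - (qform J p q 0 + L 0 + c) + polar J p q x w := by
  have h0 : qform J p q (0 : ι → K) = 0 := by simp [qform]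
  rw [qform_add, map_add, map_zero, h0]
  ring

/-- **The bias bound** `ε² ≤ |𝒟| · |ℛ|` for a quadratic `f` with polar form `B` on the coset `b₀ + D`, `ℛ` = the radical
`D ⊓ B.orthogonal D`. -/
theorem bias_sq_le [Fintype V] [DecidableEq V] (B : LinearMap.BilinForm (ZMod 2) V) (f : V → ZMod 2)
    (hf : ∀ x w, f (x + w) = f x + f w - f 0 + B x w) (D : Submodule (ZMod 2) V) (𝒟 ℛ : Finset V)
    (h𝒟 : ∀ x, x ∈ 𝒟 ↔ x ∈ D) (hℛ : ∀ x, x ∈ ℛ ↔ x ∈ D ∧ ∀ n ∈ D, B n x = 0) (b₀ : V) :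
    (∑ u ∈ 𝒟, chi (f (b₀ + u))) ^ 2 ≤ (𝒟.card : ℤ) * ℛ.card := by
  -- the function `g w = f w − f 0 + B b₀ w`
  have key : ∀ u w, f (b₀ + u) + f (b₀ + u + w) = (f w - f 0 + B b₀ w) + B u w := by
    intro u w
    rw [hf (b₀ + u) w, map_add, LinearMap.add_apply]
    have := zmod2_add_self (f (b₀ + u))
    linear_combination this
  -- ε² as a double sum, inner sum reindexed by `u' = u + w`
  have h1 : (∑ u ∈ 𝒟, chi (f (b₀ + u))) ^ 2 =
      ∑ u ∈ 𝒟, ∑ w ∈ 𝒟, chi (f w - f 0 + B b₀ w) * chi (B u w) := by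
    rw [sq, sum_mul_sum]
    refine sum_congr rfl fun u hu => ?_
    have huD : u ∈ D := (h𝒟 u).1 hu
    have hmem : ∀ w ∈ 𝒟, u + w ∈ 𝒟 := fun w hw => (h𝒟 _).2 (D.add_mem huD ((h𝒟 w).1 hw))
    have hinv : ∀ w ∈ 𝒟, u + (u + w) = w := fun w _ => by rw [← add_assoc, add_self_eq_zero, zero_add]
    rw [← sum_nbij' (fun w => u + w) (fun w => u + w) hmem hmem hinv hinv
      (fun w _ => (rfl : chi (f (b₀ + u)) * chi (f (b₀ + (u + w))) = _))]
    refine sum_congr rfl fun w _ => ?_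
    rw [← chi_add, ← chi_add, ← add_assoc, key]
  -- swap, evaluate the inner character sum
  have h2 : ∑ u ∈ 𝒟, ∑ w ∈ 𝒟, chi (f w - f 0 + B b₀ w) * chi (B u w) =
      ∑ w ∈ 𝒟, (if w ∈ ℛ then (𝒟.card : ℤ) * chi (f w - f 0 + B b₀ w) else 0) := by
    rw [sum_comm]
    refine sum_congr rfl fun w hw => ?_
    rw [← mul_sum]
    by_cases hwR : w ∈ ℛ
    · rw [if_pos hwR, sum_chi_bilin_of_forall B D 𝒟 h𝒟 ((hℛ w).1 hwR).2]; ring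
    · have hex : ∃ n ∈ D, B n w ≠ 0 := by
        by_contra hne
        push Not at hne
        exact hwR ((hℛ w).2 ⟨(h𝒟 w).1 hw, hne⟩)
      rw [if_neg hwR, sum_chi_bilin_of_exists B D 𝒟 h𝒟 hex]; ring
  -- restrict to the radical
  have h3 : ∑ w ∈ 𝒟, (if w ∈ ℛ then (𝒟.card : ℤ) * chi (f w - f 0 + B b₀ w) else 0) =
      (𝒟.card : ℤ) * ∑ w ∈ ℛ, chi (f w - f 0 + B b₀ w) := by
    have hRD : 𝒟.filter (fun w => w ∈ ℛ) = ℛ := by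
      ext w
      rw [mem_filter, h𝒟]
      exact ⟨fun h => h.2, fun h => ⟨((hℛ w).1 h).1, h⟩⟩
    rw [← sum_filter, hRD, mul_sum]
  -- bound the last sum by `|ℛ|`
  have h4 : ∑ w ∈ ℛ, chi (f w - f 0 + B b₀ w) ≤ (ℛ.card : ℤ) := by
    rw [show (ℛ.card : ℤ) = ∑ w ∈ ℛ, (1 : ℤ) by simp]
    exact sum_le_sum fun w _ => chi_le_one _
  rw [h1, h2, h3]
  exact mul_le_mul_of_nonneg_left h4 (by positivity)

end Module

/-! ## The unsat identity for two constraints -/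

/-- **Two-constraint unsat identity.**  If no `u ∈ S` satisfies both `F₁ u = 0` and `F₂ u = 0`, then
`|S| + Σ χ(F₁) + Σ χ(F₂) + Σ χ(F₁ + F₂) = 0`. -/
theorem card_add_biases_eq_zero {α : Type*} (S : Finset α) (F₁ F₂ : α → ZMod 2)
    (h : ∀ u ∈ S, F₁ u ≠ 0 ∨ F₂ u ≠ 0) :
    (S.card : ℤ) + ∑ u ∈ S, chi (F₁ u) + ∑ u ∈ S, chi (F₂ u) + ∑ u ∈ S, chi (F₁ u + F₂ u) = 0 := by
  have hterm : ∀ u ∈ S, (1 + chi (F₁ u)) * (1 + chi (F₂ u)) = 0 := by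
    intro u hu
    rcases h u hu with h1 | h2
    · rw [chi_of_ne_zero h1]; ring
    · rw [chi_of_ne_zero h2]; ring
  have hsum : ∑ u ∈ S, (1 + chi (F₁ u)) * (1 + chi (F₂ u)) = 0 := sum_eq_zero hterm
  have hexp : ∀ u, (1 + chi (F₁ u)) * (1 + chi (F₂ u)) = 1 + chi (F₁ u) + chi (F₂ u) + chi (F₁ u + F₂ u) := by
    intro u; rw [chi_add]; ring
  simp only [hexp, sum_add_distrib, sum_const, nsmul_eq_mul, mul_one] at hsum
  linarith

/-- Hence `|S| ≤ |Σ χ(F₁)| + |Σ χ(F₂)| + |Σ χ(F₁ + F₂)|`. -/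
theorem card_le_abs_add {α : Type*} (S : Finset α) (F₁ F₂ : α → ZMod 2) (h : ∀ u ∈ S, F₁ u ≠ 0 ∨ F₂ u ≠ 0) :
    (S.card : ℤ) ≤ |∑ u ∈ S, chi (F₁ u)| + |∑ u ∈ S, chi (F₂ u)| + |∑ u ∈ S, chi (F₁ u + F₂ u)| := by
  have e := card_add_biases_eq_zero S F₁ F₂ h
  have a1 := neg_abs_le (∑ u ∈ S, chi (F₁ u))
  have a2 := neg_abs_le (∑ u ∈ S, chi (F₂ u))
  have a3 := neg_abs_le (∑ u ∈ S, chi (F₁ u + F₂ u))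
  linarith

/-! ## Counting the elements of a subspace -/

/-- The element set of a subspace `P` of a finite `𝔽₂`-space has `2 ^ finrank P` elements. -/
theorem card_eq_two_pow_finrank {V : Type*} [AddCommGroup V] [Module (ZMod 2) V] [Fintype V]
    (P : Submodule (ZMod 2) V) (Pf : Finset V) (h : ∀ x, x ∈ Pf ↔ x ∈ P) :
    Pf.card = 2 ^ finrank (ZMod 2) P := by
  classical
  rw [← Fintype.card_of_subtype Pf h, Module.card_eq_pow_finrank (K := ZMod 2), ZMod.card]

end Summit.PneNP.PneNP.Theorems.PstarQuadBias
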